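/-
Copyright (c) 2026 the pub-hodgecm-mathlib formalisation cell (harness21).  Prover seat hodgecm-mathlib-F0P2-p10 (g0) (strike line L1, LEAD F0P6-plan (g14)),
Track B «K2-LIT», #184♮ = hLiu418 = `stmt-HodgeConjecture-24832`; Road I v3, S5-F3 lineage ∕ I4-conv (F′-fact), (D2): the local Haar modulus `mT` of the Klingen-fibre law.
-/
import Literature.NumberTheory.Automorphic.TateLocalZetaShells          -- ★ `map_mul_left_addHaar` (`dμ(a x) = |a|⁻¹ dμ(x)`), `normAbs`
import Literature.NumberTheory.Automorphic.AdicCompletionResidueCard   -- ★ `residueFieldCard_adicCompletion_eq`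
import Literature.NumberTheory.Automorphic.UnitaryGroupLocalFactors     -- ★ `UnitaryGroup.LocalRing E v = Π_{w ∣ v} E_w`, `PlacesOver`
import Literature.NumberTheory.Automorphic.AdelicSecondCountable        -- ★ `secondCountableTopology_adicCompletion`
import Mathlib.MeasureTheory.Constructions.Pi
import Mathlib.MeasureTheory.Measure.Haar.Unique
import HarnessLib

/-!
# Crux `HLiu418`, I4-conv (F′-fact), (D2) — `K2LiuLocalRingHaarModulus`: THE MODULUS OF `x ↦ x · u` ON `L_v = Π_{w ∣ v} L_w`
# `(Π_w μ_w) ∘ (· u)⁻¹ = (∏_w ‖u_w⁻¹‖_w) · Π_w μ_w`, `toReal = (∏_w ‖u_w‖_w)⁻¹` — the binder `hνT`∕`mT` of F0P2-p09's `innerSectionLoc_upper_mul`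

Cell `hodgecm-mathlib`, crux item hLiu418 = `stmt-HodgeConjecture-24832`; squad K2 ∕ K2Liu; LEAD F0P6-plan (g14); organ U1 (I4-conv, desk K2Liu-p14 (g3)): the local Borel
law of the Klingen-fibre inner section (F0P2-p09 `K2LiuKlingenInnerSectionLocalLaw`, hypothesis-first) takes the local Haar scaling `hνT : νT.map (· * ↑u) = mT u • νT`
BY VALUE; ★ `K2LiuKlingenInnerSectionLocalCharacter.hlaw_of_upper_mul` (F0P2-p10) takes `hmT : (mT u).toReal = (∏_w ‖u_w‖_w)⁻¹` BY VALUE.  THIS FILE pays both for the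
PRODUCT Haar measure `νT := Measure.pi μ` of the local algebra `E_v = Π_{w ∣ v} E_w` (★ `UnitaryGroup.LocalRing`; any family `μ_w` of additive Haar measures on the
completions, e.g. normalised by `μ_w(𝒪_w) = 1`): generic number fields `E ∕ F`, place `v` of `F`.
THEOREMS ONLY (no `def`, no instance, no notation, no named-fact hypothesis, no `sorry`); lane `--supports stmt-HodgeConjecture-24832 --as helper` (count-neutral).
* `norm_eq_coe_normAbs` (Mathlib's norm on `E_w` IS Tate's normalised absolute value ★ `normAbs`; the tree's bridge, reproduced with a small import closure),
  `map_mul_right_addHaar_adicCompletion` (`μ_w ∘ (· u_w)⁻¹ = ‖u_w⁻¹‖_w · μ_w`, ★ `map_mul_left_addHaar`),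
* **`pi_map_mul_right_units`** — for `U ∈ (Π_w E_w)ˣ`: `(Measure.pi μ).map (· * ↑U) = (∏_w ‖(U⁻¹)_w‖₊) • Measure.pi μ` (Mathlib `Measure.pi_eq` on boxes, factorwise scaling),
* **`toReal_prod_nnnorm_inv_units`** — `((∏_w ‖(U⁻¹)_w‖₊ : ℝ≥0) : ℝ≥0∞).toReal = (∏_w ‖U_w‖_w)⁻¹` — EXACTLY the `hmT` of ★ `hlaw_of_upper_mul`.
* §2 **`addHaar_map_mul_right_units`** — the same law for ANY additive Haar measure `νT` on `E_v` under ANY Borel structure (Mathlib `Pi.borelSpace` + Haar uniqueness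
  `Measure.isAddLeftInvariant_eq_smul`), and the unit-FAMILY forms `addHaar_map_mul_right_family` ∕ `pi_map_mul_right_family` ∕ `toReal_prod_nnnorm_inv_family`
  (`u : ∀ w, (E_w)ˣ`, Mathlib `MulEquiv.piUnits`) = BYTE-SHAPE of F0P2-p09's binder `hνT : ∀ u, νT.map (· * fun w => ↑(u w)) = mT u • νT` with `mT u := ↑(∏_w ‖↑(u w)⁻¹‖₊)`.
[Tate1950, §2.2 Lemma 2.2.5], [WeilBNT1967, Ch. I §2, Ch. IV §3], [CasselsFrohlichANT1967, Ch. II §11].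
HONEST LABEL.  Count-neutral helper: `HC_CM` is proved only modulo the 7 printed citations (2 remaining named inputs: hLiu418 = `stmt-HodgeConjecture-24832`,
h413 = `stmt-HodgeConjecture-24833`) until rung 0 closes.
-/

set_option autoImplicit false
set_option linter.dupNamespace false -- the mandated namespace repeats `HodgeConjecture.HodgeConjecture`

noncomputable section

open scoped NNReal ENNReal
open NumberField IsDedekindDomain MeasureTheory
open Literature.NumberTheory.Automorphic Literature.NumberTheory.Automorphic.UnitaryGroup
open Literature.NumberTheory.GaloisRepresentations Literature.NumberTheory.GaloisRepresentations.IsNonarchimedeanLocalField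

namespace Summit.HodgeConjecture.HodgeConjecture.Cruxes.HLiu418.K2LiuLocalRingHaarModulus

variable (F E : Type) [Field F] [NumberField F] [Field E] [NumberField E] [Algebra F E] (v : HeightOneSpectrum (𝓞 F))

omit [NumberField F] [Algebra F E] in
/-- **Mathlib's norm on `E_w` is the normalised absolute value** ★ `normAbs` of the local field `E_w` (both are `q_w^{−w(x)}`: `FinitePlace.norm_def`, ★
`normAbs_eq_inv_zpow_of_valued_eq`, ★ `residueFieldCard_adicCompletion_eq`). [cite: Tate1950, §2.2 Lemma 2.2.5] [cite: WeilBNT1967, Ch. I §2] -/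
theorem norm_eq_coe_normAbs (w : HeightOneSpectrum (𝓞 E)) (x : w.adicCompletion E) : ‖x‖ = ((normAbs (w.adicCompletion E) x : ℝ≥0) : ℝ) := by
  by_cases hx : x = 0
  · rw [hx, norm_zero, map_zero, NNReal.coe_zero]
  have hv : Valued.v x ≠ 0 := (Valuation.ne_zero_iff _).2 hx
  have hxn : Valued.v x = WithZero.exp (Multiplicative.toAdd (WithZero.unzero hv)) := by
    rw [WithZero.exp, ofAdd_toAdd, WithZero.coe_unzero]
  rw [FinitePlace.norm_def, WithZeroMulInt.toNNReal_neg_apply _ hv,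
    normAbs_eq_inv_zpow_of_valued_eq w hxn, residueFieldCard_adicCompletion_eq, _root_.inv_zpow', neg_neg]
  rfl

omit [NumberField F] [Algebra F E] in
/-- `‖x‖₊ = normAbs x` on `E_w`. [cite: Tate1950, §2.2 Lemma 2.2.5] -/
theorem nnnorm_eq_normAbs (w : HeightOneSpectrum (𝓞 E)) (x : w.adicCompletion E) : ‖x‖₊ = normAbs (w.adicCompletion E) x :=
  NNReal.coe_injective (by rw [coe_nnnorm]; exact norm_eq_coe_normAbs E w x)

omit [NumberField F] [Algebra F E] in
/-- **`μ_w ∘ (· u)⁻¹ = ‖u⁻¹‖_w · μ_w`** for an additive Haar measure `μ_w` on `E_w` and a unit `u` (★ `map_mul_left_addHaar`, commutativity). [cite: Tate1950, §2.2 Lemma 2.2.5] -/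
theorem map_mul_right_addHaar_adicCompletion (w : HeightOneSpectrum (𝓞 E)) [MeasurableSpace (w.adicCompletion E)] [BorelSpace (w.adicCompletion E)]
    (μ : Measure (w.adicCompletion E)) [μ.IsAddHaarMeasure] (u : (w.adicCompletion E)ˣ) :
    μ.map (fun x => x * (u : w.adicCompletion E)) = ((‖((u⁻¹ : (w.adicCompletion E)ˣ) : w.adicCompletion E)‖₊ : ℝ≥0) : ℝ≥0∞) • μ := by
  have h := map_mul_left_addHaar μ u.ne_zero
  rw [show (fun x => x * (u : w.adicCompletion E)) = fun x => (u : w.adicCompletion E) * x from funext fun x => mul_comm _ _, h,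
    nnnorm_eq_normAbs E w, Units.val_inv_eq_inv_val]

/-- **THE MODULUS OF `x ↦ x · U` ON `E_v = Π_{w ∣ v} E_w` FOR THE PRODUCT HAAR MEASURE**: for additive Haar measures `μ_w` and a unit `U` of the local algebra,
`(Π_w μ_w) ∘ (· U)⁻¹ = (∏_w ‖(U⁻¹)_w‖_w) · Π_w μ_w` (Mathlib `Measure.pi_eq` on boxes + `map_mul_right_addHaar_adicCompletion` factorwise). This is the binder `hνT` of
F0P2-p09's `innerSectionLoc_upper_mul` for `νT := Measure.pi μ`, with `mT U := ∏_w ‖(U⁻¹)_w‖₊`. [cite: WeilBNT1967, Ch. IV §3] [cite: CasselsFrohlichANT1967, Ch. II §11] -/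
theorem pi_map_mul_right_units [∀ w : PlacesOver E v, MeasurableSpace (w.1.adicCompletion E)] [∀ w : PlacesOver E v, BorelSpace (w.1.adicCompletion E)]
    (μ : ∀ w : PlacesOver E v, Measure (w.1.adicCompletion E)) [∀ w, (μ w).IsAddHaarMeasure] (U : (LocalRing E v)ˣ) :
    (Measure.pi μ).map (fun x : LocalRing E v => x * (U : LocalRing E v)) =
      ((∏ w : PlacesOver E v, ‖((U⁻¹ : (LocalRing E v)ˣ) : LocalRing E v) w‖₊ : ℝ≥0) : ℝ≥0∞) • Measure.pi μ := by
  haveI : ∀ w : PlacesOver E v, SecondCountableTopology (w.1.adicCompletion E) := fun w => secondCountableTopology_adicCompletion E w.1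
  haveI hσf : ∀ w : PlacesOver E v, SigmaFinite (μ w) := fun w => inferInstance
  -- the components of `U` as units of the completions
  let u : ∀ w : PlacesOver E v, (w.1.adicCompletion E)ˣ := fun w => Units.map (Pi.evalRingHom (fun w : PlacesOver E v => w.1.adicCompletion E) w).toMonoidHom U
  have hu : ∀ w, ((u w : (w.1.adicCompletion E)ˣ) : w.1.adicCompletion E) = (U : LocalRing E v) w := fun w => rfl
  have hui : ∀ w, (((u w)⁻¹ : (w.1.adicCompletion E)ˣ) : w.1.adicCompletion E) = ((U⁻¹ : (LocalRing E v)ˣ) : LocalRing E v) w := fun w => by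
    rw [← map_inv]; rfl
  have hmeas : Measurable (fun x : LocalRing E v => x * (U : LocalRing E v)) := measurable_mul_const _
  have hpre : ∀ s : ∀ w : PlacesOver E v, Set (w.1.adicCompletion E), (fun x : LocalRing E v => x * (U : LocalRing E v)) ⁻¹' Set.univ.pi s =
      Set.univ.pi fun w => (fun y : w.1.adicCompletion E => y * (u w : w.1.adicCompletion E)) ⁻¹' s w := fun s => by
    ext x
    simp only [Set.mem_preimage, Set.mem_univ_pi, Pi.mul_apply, hu]
  -- the scalar `C = ∏_w ‖u_w⁻¹‖` is neither `0` nor `∞`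
  set C : ℝ≥0∞ := ((∏ w : PlacesOver E v, ‖((U⁻¹ : (LocalRing E v)ˣ) : LocalRing E v) w‖₊ : ℝ≥0) : ℝ≥0∞) with hC
  have hC0 : C ≠ 0 := by
    rw [hC, ENNReal.coe_ne_zero]
    exact Finset.prod_ne_zero_iff.2 fun w _ => by rw [← hui w]; exact nnnorm_ne_zero_iff.2 (u w)⁻¹.ne_zero
  have hCtop : C ≠ ∞ := ENNReal.coe_ne_top
  -- the box values of `C⁻¹ • (Π μ) ∘ (· U)⁻¹` are `∏_w μ_w(s_w)`, so it IS `Π μ`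
  have key : Measure.pi μ = C⁻¹ • (Measure.pi μ).map (fun x : LocalRing E v => x * (U : LocalRing E v)) := by
    refine Measure.pi_eq (μ := μ) fun s hs => ?_
    -- factorwise modulus
    have hfac : ∀ w : PlacesOver E v, μ w ((fun y : w.1.adicCompletion E => y * (u w : w.1.adicCompletion E)) ⁻¹' s w) =
        ((‖(((u w)⁻¹ : (w.1.adicCompletion E)ˣ) : w.1.adicCompletion E)‖₊ : ℝ≥0) : ℝ≥0∞) * μ w (s w) := fun w => by
      rw [← Measure.map_apply (measurable_mul_const _) (hs w), map_mul_right_addHaar_adicCompletion E w.1 (μ w) (u w), Measure.smul_apply, smul_eq_mul]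
    -- the product of the factorwise moduli is `C`
    have hC1 : C⁻¹ * ∏ w : PlacesOver E v, ((‖(((u w)⁻¹ : (w.1.adicCompletion E)ˣ) : w.1.adicCompletion E)‖₊ : ℝ≥0) : ℝ≥0∞) = 1 := by
      rw [← ENNReal.ofNNReal_finsetProd, show (∏ w : PlacesOver E v, ‖(((u w)⁻¹ : (w.1.adicCompletion E)ˣ) : w.1.adicCompletion E)‖₊) =
        ∏ w : PlacesOver E v, ‖((U⁻¹ : (LocalRing E v)ˣ) : LocalRing E v) w‖₊ from Finset.prod_congr rfl fun w _ => by rw [hui w], ← hC]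
      exact ENNReal.inv_mul_cancel hC0 hCtop
    -- the box value of the product measure
    have hbox : Measure.pi μ (Set.univ.pi fun w => (fun y : w.1.adicCompletion E => y * (u w : w.1.adicCompletion E)) ⁻¹' s w) =
        ∏ w : PlacesOver E v, μ w ((fun y : w.1.adicCompletion E => y * (u w : w.1.adicCompletion E)) ⁻¹' s w) := Measure.pi_pi μ _
    rw [Measure.smul_apply, Measure.map_apply hmeas (MeasurableSet.univ_pi hs), hpre s]
    refine (congrArg (fun t : ℝ≥0∞ => C⁻¹ • t) hbox).trans ?_
    rw [smul_eq_mul]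
    simp only [hfac, Finset.prod_mul_distrib]
    rw [← mul_assoc, hC1, one_mul]
  calc (Measure.pi μ).map (fun x : LocalRing E v => x * (U : LocalRing E v))
      = C • (C⁻¹ • (Measure.pi μ).map (fun x : LocalRing E v => x * (U : LocalRing E v))) := by
          rw [smul_smul, ENNReal.mul_inv_cancel hC0 hCtop, one_smul]
    _ = C • Measure.pi μ := by rw [← key]

/-- **`toReal` of the modulus: `((∏_w ‖(U⁻¹)_w‖₊ : ℝ≥0) : ℝ≥0∞).toReal = (∏_w ‖U_w‖_w)⁻¹`** — EXACTLY the binder `hmT` of ★ `K2LiuKlingenInnerSectionLocalCharacter.hlaw_of_upper_mul`.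
[cite: WeilBNT1967, Ch. IV §3] -/
theorem toReal_prod_nnnorm_inv_units (U : (LocalRing E v)ˣ) :
    (((∏ w : PlacesOver E v, ‖((U⁻¹ : (LocalRing E v)ˣ) : LocalRing E v) w‖₊ : ℝ≥0) : ℝ≥0∞)).toReal =
      (∏ w : PlacesOver E v, ‖(U : LocalRing E v) w‖)⁻¹ := by
  rw [ENNReal.coe_toReal, NNReal.coe_prod, ← Finset.prod_inv_distrib]
  refine Finset.prod_congr rfl fun w _ => ?_
  have h : ((U⁻¹ : (LocalRing E v)ˣ) : LocalRing E v) w * (U : LocalRing E v) w = 1 := by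
    rw [← Pi.mul_apply, Units.inv_mul, Pi.one_apply]
  rw [coe_nnnorm]
  exact eq_inv_of_mul_eq_one_left (by rw [← norm_mul, h, norm_one])

/-! ## §2 The same modulus for ANY additive Haar measure on `E_v` (abstract Borel structure), and for unit FAMILIES `u : ∀ w, (E_w)ˣ`
(the index conventions of F0P2-p09's `innerSectionLoc_upper_mul`: `hνT : ∀ u, νT.map (· * fun w => ↑(u w)) = mT u • νT`) -/

/-- **THE MODULUS FOR AN ARBITRARY ADDITIVE HAAR MEASURE `ν_T` ON `E_v = Π_{w ∣ v} E_w`** (any Borel structure on `E_v`): `ν_T ∘ (· U)⁻¹ = (∏_w ‖(U⁻¹)_w‖_w) · ν_T`.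
Proof: the Borel σ-algebra of the second-countable product is the product of the Borel σ-algebras (Mathlib `Pi.borelSpace`), `ν_T` is a scalar multiple of a
product Haar measure (Mathlib `Measure.isAddLeftInvariant_eq_smul`), and §1 `pi_map_mul_right_units`. [cite: WeilBNT1967, Ch. I §2, Ch. IV §3] [cite: Tate1950, §2.2 Lemma 2.2.5] -/
theorem addHaar_map_mul_right_units [MeasurableSpace (LocalRing E v)] [BorelSpace (LocalRing E v)] (νT : Measure (LocalRing E v)) [νT.IsAddHaarMeasure]
    (U : (LocalRing E v)ˣ) :
    νT.map (fun x : LocalRing E v => x * (U : LocalRing E v)) =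
      ((∏ w : PlacesOver E v, ‖((U⁻¹ : (LocalRing E v)ˣ) : LocalRing E v) w‖₊ : ℝ≥0) : ℝ≥0∞) • νT := by
  haveI : ∀ w : PlacesOver E v, SecondCountableTopology (w.1.adicCompletion E) := fun w => secondCountableTopology_adicCompletion E w.1
  letI mw : ∀ w : PlacesOver E v, MeasurableSpace (w.1.adicCompletion E) := fun w => borel _
  haveI : ∀ w : PlacesOver E v, BorelSpace (w.1.adicCompletion E) := fun w => ⟨rfl⟩
  -- the given Borel structure on `E_v` IS the product structure
  have hm : ‹MeasurableSpace (LocalRing E v)› = MeasurableSpace.pi :=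
    (BorelSpace.measurable_eq (α := LocalRing E v)).trans (@BorelSpace.measurable_eq (LocalRing E v) _ MeasurableSpace.pi Pi.borelSpace).symm
  subst hm
  -- a reference product Haar measure, of which `νT` is a multiple
  let μ : ∀ w : PlacesOver E v, Measure (w.1.adicCompletion E) := fun w => Measure.addHaar
  haveI : SecondCountableTopology (LocalRing E v) := inferInstance
  have hν : νT = νT.addHaarScalarFactor (Measure.pi μ) • Measure.pi μ := Measure.isAddLeftInvariant_eq_smul νT (Measure.pi μ)
  rw [hν, Measure.map_smul, pi_map_mul_right_units F E v μ U, smul_comm]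

/-- **family-indexed form of `addHaar_map_mul_right_units`** — BYTE-SHAPE of F0P2-p09's binder `hνT` (`K2LiuKlingenInnerSectionLocalLaw.innerSectionLoc_upper_mul`) with
`mT u := ↑(∏_w ‖↑(u w)⁻¹‖₊)`, for ANY additive Haar measure `νT` on `E_v` (Mathlib `MulEquiv.piUnits`: `(Π_w E_w)ˣ = Π_w E_wˣ`). [cite: WeilBNT1967, Ch. IV §3] -/
theorem addHaar_map_mul_right_family [MeasurableSpace (LocalRing E v)] [BorelSpace (LocalRing E v)] (νT : Measure (LocalRing E v)) [νT.IsAddHaarMeasure]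
    (u : ∀ w : PlacesOver E v, (w.1.adicCompletion E)ˣ) :
    νT.map (fun t : LocalRing E v => t * fun w => (u w : w.1.adicCompletion E)) =
      ((∏ w : PlacesOver E v, ‖(((u w)⁻¹ : (w.1.adicCompletion E)ˣ) : w.1.adicCompletion E)‖₊ : ℝ≥0) : ℝ≥0∞) • νT :=
  addHaar_map_mul_right_units F E v νT (MulEquiv.piUnits.symm u)

/-- **family-indexed form of `pi_map_mul_right_units`** (the product Haar measure; the same `mT u := ↑(∏_w ‖↑(u w)⁻¹‖₊)`). [cite: WeilBNT1967, Ch. IV §3] -/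
theorem pi_map_mul_right_family [∀ w : PlacesOver E v, MeasurableSpace (w.1.adicCompletion E)] [∀ w : PlacesOver E v, BorelSpace (w.1.adicCompletion E)]
    (μ : ∀ w : PlacesOver E v, Measure (w.1.adicCompletion E)) [∀ w, (μ w).IsAddHaarMeasure] (u : ∀ w : PlacesOver E v, (w.1.adicCompletion E)ˣ) :
    (Measure.pi μ).map (fun t : LocalRing E v => t * fun w => (u w : w.1.adicCompletion E)) =
      ((∏ w : PlacesOver E v, ‖(((u w)⁻¹ : (w.1.adicCompletion E)ˣ) : w.1.adicCompletion E)‖₊ : ℝ≥0) : ℝ≥0∞) • Measure.pi μ :=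
  pi_map_mul_right_units F E v μ (MulEquiv.piUnits.symm u)

/-- **`toReal` of the family-indexed modulus**: `(↑(∏_w ‖↑(u w)⁻¹‖₊)).toReal = (∏_w ‖↑(u w)‖_w)⁻¹` — the `hmT` of ★ `K2LiuKlingenInnerSectionLocalCharacter.hlaw_of_upper_mul` read
through `MulEquiv.piUnits`. [cite: WeilBNT1967, Ch. IV §3] -/
theorem toReal_prod_nnnorm_inv_family (u : ∀ w : PlacesOver E v, (w.1.adicCompletion E)ˣ) :
    (((∏ w : PlacesOver E v, ‖(((u w)⁻¹ : (w.1.adicCompletion E)ˣ) : w.1.adicCompletion E)‖₊ : ℝ≥0) : ℝ≥0∞)).toReal =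
      (∏ w : PlacesOver E v, ‖(u w : w.1.adicCompletion E)‖)⁻¹ :=
  toReal_prod_nnnorm_inv_units F E v (MulEquiv.piUnits.symm u)

end Summit.HodgeConjecture.HodgeConjecture.Cruxes.HLiu418.K2LiuLocalRingHaarModulus

end
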